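import Summits.BirchSwinnertonDyer.BirchSwinnertonDyer.Theorems.KimAtThreeDeepUpperBadPlaceCondition
import Summits.BirchSwinnertonDyer.BirchSwinnertonDyer.Theorems.KimAtThreeDeepUpperOffStratumLocalIndex
import Literature.NumberTheory.GaloisRepresentations.HOneUnramifiedProcyclic
import HarnessLib

/-!
# D7-u, the 𝓕_u form ([MR04] Remark A.5 verbatim), ALL `p`: Kolyvagin's derivative class of an Euler
# system of `T_pE` unramified above a finite place `w ∤ p`, `w ∉ r`, is at `w` the reduction of an
# UNRAMIFIED class of `H¹(ℚ_w, T_pE)` — `loc_w (Φ κ_r) ∈ 𝓕_u(w) := im(H¹_ur(ℚ_w, T_pE) → H¹(ℚ_w, E[p^{k+1}]))`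
# (cell `bsd-addord`, seat w2-tamdiv gen 2; route W2 `KimAtThreeKolyvagin`, crux 19560 (C3) / TamDiv∞)

HONEST FRAMING: TOOL theorems of continuous Galois cohomology (no definition, no named fact, no
`sorry`); closes nothing by itself; nothing is booked; BSD is not proved by any of this.  `--supports`
item 19560 (`KatoKuriharaPortThreeShared`): the (C3) residual of THEOREM D at the ANOMALOUS bad places and
the Kolyvagin-system form of «TamDiv∞» are both the statement that Kato's derivative classes satisfy the
UNRAMIFIED local condition `𝓕_u ≤ 𝓕_can` at the bad places `w ∤ p·n` ([MR04] Remark A.5, used in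
[MR04] Prop. 6.2.6; Büyükboduk 2009 Thm. 3.1).  The tree had this (i) in `𝓕_can`-form and at `p = 3`
only — w2-c3's `KimAtThreeDeepUpperBadPlaceCondition.localization_mem_propagatedSelmerStructure_three_of_unramified`
(THEOREM B-u + U4 + the level-`k` stable range `PropagatedConditionStableRangeThree`, typed at `3`;
`KimAtThreeDeepUpperBadPlaceClause`: «p = 3 only») — and (ii) at cochain level (THEOREM B-u
`KimAtThreeDeepUpperBadPlaceDescent.exists_rep_apply_eq_red_invariant_of_unramified`; w2-tamdiv g0's
refined-module twin `KimAtThreeD7uRefinedDescent.exists_apply_sub_mem_and_apply_eq`).  This file lands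
the LITERAL `𝓕_u` statement, for every prime `p` and depth `k`, with the `𝓕_can` statement for every
`p` as a corollary (no stable range, no finite detour: the unramified class of `T_pE` is produced
directly by the profinite unramified `H¹` package of w2-acc5 g3, `HOneUnramifiedProcyclic` /
`LocalHOneInertiaRestrictionProfinite`, instantiated in `KimAtThreeDeepUpperOffStratumLocalIndex` §2).

## What

* §1 (local, any `p`, `k`, finite `w`): `exists_unramified_tateLocalMap_eq_of_vanishing_inertia` — an
  `I_w`-vanishing continuous cocycle `ψ : Γ_{ℚ_w} → E[p^k·p]` whose value at a Frobenius lift `φ` is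
  `π_{k+1}(t)` with `t ∈ T_pE^{I_w}` has class `π_{k+1,*} y` for an UNRAMIFIED `y ∈ H¹(ℚ_w, T_pE)`
  (`res_{I_w} y = 0`): `y = [z]` for the `I_w`-vanishing `T_pE`-cocycle `z` with `z(φ) = t`
  (`exists_vanishing_apply_eq_inertia`), `[π ∘ z] = [ψ]` because an `I_w`-vanishing cocycle is determined
  up to a coboundary by its value at `φ` (`oneCocycleClass_eq_iff_of_vanishing_absInertia`);
  `…_of_forall_vanishing_inertia` — the same from the THEOREM B-u shape (all values in `π_{k+1}(T_pE^{I_w})`).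
* §2 (global → local, any `p`): **`exists_unramified_tateLocalMap_eq_localization_of_unramified`** — for
  an Euler system `c` of `T_pE` over levels `L`, THEOREM A's bottom-layer data, a coefficient
  representation `T′` pinned to `E[p^k·p]` by `(red, e, hcomp)`, a transport `Φ` computed on cocycles by
  `e`, Kolyvagin's class `κ` (`res_{U_r} κ = D_r (red_* c_{⊥,r})`) and a finite place `w` unramified in
  `U_r` above which every `c_{⊥,s}`, `s ⊆ r`, is unramified (`hur` = conjunct (C2) of the tree's
  `ZetaBody`, Kato (8.1.3)): **there is `y ∈ H¹(ℚ_w, T_pE)` with `res_{I_w} y = 0` and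
  `π_{k+1,*} y = loc_w (Φ κ)`** — verbatim the binders of w2-c3's theorem with `3 ↦ p`.
* §3 corollary (any `p`): `localization_mem_propagatedSelmerStructure_of_unramified` — w2-c3's
  conclusion `loc_w (Φ κ) ∈ propagatedSelmerStructure W p k (Sum.inr w)` for EVERY `p`
  (`𝓕_u(w) ≤ 𝓕_can(w)` is `mem_propagatedSelmerStructure_iff`).
The companion file `KimAtThreeD7uUnramifiedMembershipCyclotomic` reads §2/§3 on Kato's cyclotomic levels
`cyclotomicLevelsRat p S` (THEOREM D's local clause at `w ∉ r ∪ {p}` without thinning, every `p`).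

References: B. Mazur, K. Rubin, *Kolyvagin systems*, Mem. AMS 799 (2004), Def. 3.2.1, Thm. 3.2.4,
App. A Prop. A.2 and Remark A.5 (p. 81), Prop. 6.2.6 (p. 75); K. Rubin, *Euler Systems* (2000), Lemma 1.3.2,
Lemma 1.3.5, Lemma 4.4.2, Thm. 4.5.1; K. Kato, Astérisque 295 (2004), (8.1.3), §8.2, Lemma 8.5;
K. Büyükboduk, J. Number Theory 129 (2009) §2.1.2, Thm. 3.1; J.-P. Serre, *Local Fields*, XIII §1.
-/

noncomputable section

-- the cell's Theorems namespace `Summit.BirchSwinnertonDyer.BirchSwinnertonDyer.…` repeats the summit name by design (D-0017)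
set_option linter.dupNamespace false

open CategoryTheory Function Finset Polynomial Field IsDedekindDomain NumberField
open scoped NumberField Classical Pointwise
open Literature.NumberTheory.GaloisRepresentations Literature.NumberTheory.EllipticCurves
open Literature.NumberTheory.GaloisRepresentations.IsNonarchimedeanLocalField
open WeierstrassCurve
open Summit.BirchSwinnertonDyer.Rank1Residual.GaloisImage
open Summit.BirchSwinnertonDyer.Rank1Residual.GaloisImage.Derivative
open Summit.BirchSwinnertonDyer.Rank1Residual.GaloisImage.CoeffTransport
open Summit.BirchSwinnertonDyer.BirchSwinnertonDyer.Theorems.KimAtThreeDeepUpperBadPlaceDescent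
open Summit.BirchSwinnertonDyer.BirchSwinnertonDyer.Theorems.KimAtThreeDeepUpperOffStratumLocalIndex

universe w

namespace Summit.BirchSwinnertonDyer.BirchSwinnertonDyer.Theorems.KimAtThreeD7uUnramifiedMembership

/-! ### §1 The local `𝓕_u` lift at a finite place (any `p`, `k`, `w`) -/

section Local

variable (W : WeierstrassCurve ℚ) [W.IsElliptic] (p : ℕ) [hp : Fact p.Prime] (k : ℕ)
  (w : HeightOneSpectrum (𝓞 ℚ))

/-- Local notation: `T_pE|_{Γ_{ℚ_w}}` (= `tateLocalRep W p (Sum.inr w)`, by `rfl`). -/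
local notation3 "𝕋" => (GaloisRep.restrictField (HeightOneSpectrum.adicCompletion ℚ w)
  (WeierstrassCurve.tateGaloisRep W p (W.continuous_galoisRepTate_holds p)).toIntRep)
/-- Local notation: `E[p^k · p]|_{Γ_{ℚ_w}}` (= `(W.torsionGaloisModule (p^k · p)).toLocal (Sum.inr w)`). -/
local notation3 "𝕄" => (GaloisRep.restrictField (HeightOneSpectrum.adicCompletion ℚ w)
  (W.torsionGaloisModule ((p : ℤ) ^ k * (p : ℤ))))

/-- **The local `𝓕_u` lift.**  For a prime `p`, a depth `k`, a finite place `w` of `ℚ` and an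
arithmetic Frobenius lift `φ ∈ Γ_{ℚ_w}` (`IsFrobPow φ 1`): if a continuous cocycle
`ψ : Γ_{ℚ_w} → E[p^k · p]` VANISHES on `I_w = absInertia ℚ_w` and `ψ(φ) = π_{k+1}(t)` for some
`t ∈ T_pE^{I_w}`, then `[ψ] = π_{k+1,*} y` for some `y ∈ H¹(ℚ_w, T_pE)` with `res_{I_w} y = 0`, i.e.
`[ψ] ∈ 𝓕_u(w) = im(H¹_ur(ℚ_w, T_pE) → H¹(ℚ_w, E[p^k · p]))` ([MR04] Remark A.5's local condition).
[cite: MazurRubin2004, App. A Remark A.5 (p. 81)] [cite: Rubin2000, Lemma 1.3.2] -/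
theorem exists_unramified_tateLocalMap_eq_of_vanishing_inertia
    {φ : absoluteGaloisGroup (w.adicCompletion ℚ)} (hφ : IsFrobPow φ 1)
    (ψ : contOneCocycles (DiscreteGaloisModule.toTopRep 𝕄))
    (hψI : ∀ n : absInertia (w.adicCompletion ℚ), ψ.1 n = 0)
    (hψφ : ∃ t : W.tateModule p,
      (∀ n : absInertia (w.adicCompletion ℚ), (𝕋).toTopRep.ρ (n : absoluteGaloisGroup (w.adicCompletion ℚ)) t = t) ∧
        ((ψ.1 φ : geomTorsion W ((p : ℤ) ^ k * (p : ℤ))) : geomPoints W) = TateModule.proj p (k + 1) t) :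
    ∃ y : (tateLocalRep W p (Sum.inr w)).cohomology 1,
      resSubgroup (tateLocalRep W p (Sum.inr w)).toTopRep (absInertia (w.adicCompletion ℚ)) 1 y = 0 ∧
        tateLocalMap W p k (Sum.inr w) y = oneCocycleClass _ ψ := by
  obtain ⟨t, ht, hψt⟩ := hψφ
  obtain ⟨z, hzI, hzφ⟩ := exists_vanishing_apply_eq_inertia W p w hφ ht
  refine ⟨oneCocycleClass _ z, resSubgroup_oneCocycleClass_eq_zero_of_vanishing _ z hzI, ?_⟩
  -- the push-forward `ζ = π_{k+1} ∘ z` vanishes on `I_w` and agrees with `ψ` at `φ`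
  let ζ : contOneCocycles (DiscreteGaloisModule.toTopRep 𝕄) := pushCocycle W p k (Sum.inr w) z
  have hζ : ∀ g, ζ.1 g = tateToTorsion W p k (z.1 g) := fun g => rfl
  have hζI : ∀ n : absInertia (w.adicCompletion ℚ), ζ.1 n = 0 := fun n => by rw [hζ, hzI n, map_zero]
  have hψζ : ψ.1 φ = ζ.1 φ := Subtype.ext (by rw [hψt, hζ, hzφ]; rfl)
  have hcl : oneCocycleClass _ ψ = oneCocycleClass _ ζ := by
    rw [oneCocycleClass_eq_iff_of_vanishing_absInertia (w.adicCompletion ℚ) (DiscreteGaloisModule.toTopRep 𝕄)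
      (𝕄).continuous_smul hφ ψ ζ hψI hζI]
    exact ⟨0, fun _ => map_zero _, by rw [map_zero, sub_zero, sub_eq_zero, hψζ]⟩
  rw [hcl]
  exact tateLocalMap_oneCocycleClass W p k (Sum.inr w) z

/-- **The local `𝓕_u` lift, THEOREM B-u form.**  If a continuous cocycle `ψ : Γ_{ℚ_w} → E[p^k · p]`
vanishes on `I_w` and takes ALL its values in `π_{k+1}(T_pE^{I_w})`, then `[ψ] = π_{k+1,*} y` for an
unramified `y ∈ H¹(ℚ_w, T_pE)` (`res_{I_w} y = 0`); every `p` and `k`.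
[cite: MazurRubin2004, App. A Remark A.5 (p. 81)] [cite: Rubin2000, Lemma 1.3.2] -/
theorem exists_unramified_tateLocalMap_eq_of_forall_vanishing_inertia
    (ψ : contOneCocycles (DiscreteGaloisModule.toTopRep 𝕄))
    (hψI : ∀ n : absInertia (w.adicCompletion ℚ), ψ.1 n = 0)
    (hψD : ∀ g : absoluteGaloisGroup (w.adicCompletion ℚ), ∃ t : W.tateModule p,
      (∀ n : absInertia (w.adicCompletion ℚ), (𝕋).toTopRep.ρ (n : absoluteGaloisGroup (w.adicCompletion ℚ)) t = t) ∧
        ((ψ.1 g : geomTorsion W ((p : ℤ) ^ k * (p : ℤ))) : geomPoints W) = TateModule.proj p (k + 1) t) :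
    ∃ y : (tateLocalRep W p (Sum.inr w)).cohomology 1,
      resSubgroup (tateLocalRep W p (Sum.inr w)).toTopRep (absInertia (w.adicCompletion ℚ)) 1 y = 0 ∧
        tateLocalMap W p k (Sum.inr w) y = oneCocycleClass _ ψ := by
  obtain ⟨φ, hφ⟩ := exists_isFrobPow_holds (F := w.adicCompletion ℚ) 1
  exact exists_unramified_tateLocalMap_eq_of_vanishing_inertia W p k w hφ ψ hψI (hψD φ)

/-- `𝓕_u(w) ≤ 𝓕_can(w)`: a class of the form `π_{k+1,*} y` lies in `propagatedSelmerStructure W p k (Sum.inr w)`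
(restatement of `mem_propagatedSelmerStructure_iff` in the shape produced by §1/§2).
[cite: MazurRubin2004, App. A Remark A.5 (p. 81)] -/
theorem mem_propagatedSelmerStructure_of_exists_tateLocalMap_eq
    {x : galoisCohomology ((W.torsionGaloisModule ((p : ℤ) ^ k * (p : ℤ))).toLocal (Sum.inr w)) 1}
    (hx : ∃ y : (tateLocalRep W p (Sum.inr w)).cohomology 1,
      resSubgroup (tateLocalRep W p (Sum.inr w)).toTopRep (absInertia (w.adicCompletion ℚ)) 1 y = 0 ∧
        tateLocalMap W p k (Sum.inr w) y = x) :
    x ∈ propagatedSelmerStructure W p k (Sum.inr w) := by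
  obtain ⟨y, -, hy⟩ := hx
  exact (mem_propagatedSelmerStructure_iff W p k (Sum.inr w) x).mpr ⟨y, hy⟩

end Local

/-! ### §2 The `𝓕_u` END: Kolyvagin's derivative class is the reduction of an unramified class (any `p`) -/

section Global

variable (W : WeierstrassCurve ℚ) [W.IsElliptic] (p : ℕ) [Fact p.Prime]
variable [Module.Free ℤ_[p] (W.tateModule p)] [Module.Finite ℤ_[p] (W.tateModule p)]
  [ContinuousSMul ℤ_[p] (W.tateModule p)]

/-- Local notation: `T∞ = T_p E` as a continuous `Γ_ℚ`-representation. -/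
local notation3 "T∞" => WeierstrassCurve.tateGaloisRep W p (W.continuous_galoisRepTate_holds p)

/-- **D7-u, `𝓕_u` form, every `p`** ([MR04] Remark A.5 «the classes `κ_n` lie in `H¹_{(𝓕_u)_n}`», at
the place `w`; module docstring).  For an Euler system `c` of `T_pE` over levels `L`, THEOREM A's
bottom-layer data, a `ℤ_p`-linear coefficient representation `T′` pinned to `E[p^k·p]` by
`(red, e, hcomp)` and a transport `Φ` computed on cocycles by `e`, Kolyvagin's class `κ`
(`res_{U_r} κ = D_r (red_* c_{⊥,r})`), and a finite place `w` unramified in `U_r` above which every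
`c_{⊥,s}`, `s ⊆ r`, is unramified: **`loc_w (Φ κ) = π_{k+1,*} y` for some `y ∈ H¹(ℚ_w, T_pE)` with
`res_{I_w} y = 0`.**  No hypothesis on the primes of `r` besides `w ∉ r` (through `hwU`), none on
the reduction of `E` at `w`, none on `E(ℚ_w)[p]`, none on `p`.
[cite: MazurRubin2004, Def. 3.2.1, Thm. 3.2.4 and App. A Remark A.5 (p. 81)]
[cite: Rubin2000, Lemma 1.3.2, Lemma 4.4.2 and Thm. 4.5.1] -/
theorem exists_unramified_tateLocalMap_eq_localization_of_unramified
    {ι : Type w} [Preorder ι] [OrderBot ι] {L : EulerSystemLevels ℚ ι}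
    {c : ∀ (i : ι) (r : L.Ideals), H1 T∞ (L.level i r.1)} (hc : IsEulerSystem L T∞ p c)
    {M' : Type} [AddCommGroup M'] [Module ℤ_[p] M'] [TopologicalSpace M'] [IsTopologicalAddGroup M']
    [ContinuousSMul ℤ_[p] M'] {T' : GaloisRep ℚ ℤ_[p] M'}
    (red : (T∞).toTopRep ⟶ T'.toTopRep) (k : ℕ)
    (e : M' →+ geomTorsion W (((p : ℕ) : ℤ) ^ k * ((p : ℕ) : ℤ))) (hec : Continuous e)
    (he : ∀ (g : absoluteGaloisGroup ℚ) (x : M'),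
      e (T' g x) = W.torsionGaloisModule (((p : ℕ) : ℤ) ^ k * ((p : ℕ) : ℤ)) g (e x))
    (hcomp : ∀ a : W.tateModule p, tateToTorsion W p k a = e (red.hom a))
    (Φ : continuousCohomology 1 T'.toTopRep →+
      galoisCohomology (W.torsionGaloisModule (((p : ℕ) : ℤ) ^ k * ((p : ℕ) : ℤ))) 1)
    (hΦ : ∀ (φ : contOneCocycles T'.toTopRep)
      (ψ : contOneCocycles (W.torsionGaloisModule (((p : ℕ) : ℤ) ^ k * ((p : ℕ) : ℤ))).toTopRep),
      (∀ g, ψ.1 g = e (φ.1 g)) → Φ (oneCocycleClass _ φ) = oneCocycleClass _ ψ)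
    (r : L.Ideals)
    (σ : HeightOneSpectrum (𝓞 ℚ) → absoluteGaloisGroup ℚ) (N : HeightOneSpectrum (𝓞 ℚ) → ℕ)
    (Fr : HeightOneSpectrum (𝓞 ℚ) → absoluteGaloisGroup ℚ)
    (hσ : ∀ ℓ ∈ r.1, ∀ q ∈ r.1, q ≠ ℓ → σ ℓ ∈ L.tameLevel q)
    (hcov : ∀ ℓ ∈ r.1, ∀ g : absoluteGaloisGroup ℚ, ∃ j < N ℓ, (σ ℓ ^ j)⁻¹ * g ∈ L.tameLevel ℓ)
    (hinj : ∀ ℓ ∈ r.1, ∀ j₁ < N ℓ, ∀ j₂ < N ℓ, (σ ℓ ^ j₁)⁻¹ * σ ℓ ^ j₂ ∈ L.tameLevel ℓ → j₁ = j₂)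
    (hFr : ∀ ℓ ∈ r.1, IsArithFrobAtPlace ℚ ℓ (Fr ℓ))
    (hram : ∀ ℓ ∈ r.1, ∀ s ⊆ r.1, ℓ ∉ s → ¬ SubgroupIsUnramifiedAt ℚ (L.level ⊥ (insert ℓ s)) ℓ)
    (hM₁ : ∀ ℓ ∈ r.1, ∀ v : M', (N ℓ : ℤ_[p]) • v = 0)
    (hM₂ : ∀ ℓ ∈ r.1, ∀ v : M',
      (rubinEulerFactor (T∞).toRepresentation (cyclotomicCharacterToUnits ℚ p ℤ_[p]) (Fr ℓ)).eval 1 •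
        v = 0)
    (comm)
    (h0 : ∀ v : T'.toTopRep, (∀ u : L.level ⊥ r.1, T'.toTopRep.ρ (u : absoluteGaloisGroup ℚ) v = v) →
      v = 0)
    (κ : continuousCohomology 1 T'.toTopRep)
    (hκ : resSubgroup T'.toTopRep (L.level ⊥ r.1) 1 κ =
        (r.1.noncommProd (fun ℓ => ∑ j ∈ range (N ℓ), (j : Module.End ℤ_[p] (continuousCohomology 1
          (subgroupRep T'.toTopRep (L.level ⊥ r.1)))) *
          (conjMap T'.toTopRep (L.level ⊥ r.1) (σ ℓ) 1).hom.toLinearMap ^ j) comm)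
        (ContinuousCohomology.map (ContinuousMonoidHom.id _) (X := subgroupRep (T∞).toTopRep (L.level ⊥ r.1))
          (Y := subgroupRep T'.toTopRep (L.level ⊥ r.1))
          ((TopRep.resFunctor (L.level ⊥ r.1).subtype).map red) 1 (c ⊥ r)))
    (w : HeightOneSpectrum (𝓞 ℚ)) (hwU : SubgroupIsUnramifiedAt ℚ (L.level ⊥ r.1) w)
    (hur : ∀ (s : Finset (HeightOneSpectrum (𝓞 ℚ))) (hs : s ⊆ r.1)
      (𝔓 : Ideal (absIntegers (𝓞 ℚ) ℚ)) (h𝔓 : 𝔓 ∈ w.primesAbove),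
      resLe (T∞).toTopRep (hwU 𝔓 h𝔓) 1
        (resLe (T∞).toTopRep (level_antitone L ⊥ hs) 1 (c ⊥ ⟨s, fun q hq => r.2 q (hs hq)⟩)) = 0) :
    ∃ y : (tateLocalRep W p (Sum.inr w)).cohomology 1,
      resSubgroup (tateLocalRep W p (Sum.inr w)).toTopRep (absInertia (w.adicCompletion ℚ)) 1 y = 0 ∧
        tateLocalMap W p k (Sum.inr w) y =
          galoisCohomology.localization (W.torsionGaloisModule (((p : ℕ) : ℤ) ^ k * ((p : ℕ) : ℤ)))
            (Sum.inr w) 1 (Φ κ) := by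
  classical
  set F := w.adicCompletion ℚ with hFdef
  set θ : absoluteGaloisGroup F →ₜ* absoluteGaloisGroup ℚ := absGaloisRestrict ℚ F with hθdef
  set 𝔓₀ : Ideal (absIntegers (𝓞 ℚ) ℚ) := adicCompletionPrime ℚ w with h𝔓₀def
  -- (1) THEOREM B-u
  obtain ⟨kk, v, hκk, hI, hD⟩ := exists_rep_apply_eq_red_invariant_of_unramified hc red r σ N Fr hσ
    hcov hinj hFr hram hM₁ hM₂ comm h0 κ hκ w hwU hur
  -- the adjusted cocycle `k′ = k − ∂v`
  have hT'c : ∀ x : T'.toTopRep, Continuous fun g : absoluteGaloisGroup ℚ => T'.toTopRep.ρ g x :=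
    fun x => T'.continuous_apply_left x
  let δ : contOneCocycles T'.toTopRep :=
    ⟨⟨fun g => T'.toTopRep.ρ g v - v, (hT'c v).sub continuous_const⟩, fun g h => by
        change T'.toTopRep.ρ (g * h) v - v = (T'.toTopRep.ρ g v - v) + T'.toTopRep.ρ g (T'.toTopRep.ρ h v - v)
        rw [map_sub, ρ_mul_apply]; abel⟩
  have hδ : oneCocycleClass _ δ = 0 := (oneCocycleClass_eq_zero_iff T'.toTopRep δ).mpr ⟨v, fun _ => rfl⟩
  set k' : contOneCocycles T'.toTopRep := kk - δ with hk'def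
  have hk'cl : oneCocycleClass _ k' = κ := by
    rw [hk'def, oneCocycleClass_sub, hδ, sub_zero, hκk]
  have hk'app : ∀ g, k'.1 g = kk.1 g - (T'.toTopRep.ρ g v - v) := fun g => rfl
  -- `Φ κ = [e ∘ k′]`
  let ψ : contOneCocycles (W.torsionGaloisModule (((p : ℕ) : ℤ) ^ k * ((p : ℕ) : ℤ))).toTopRep :=
    ⟨_, comp_mem_contOneCocycles T'.toTopRep
      (W.torsionGaloisModule (((p : ℕ) : ℤ) ^ k * ((p : ℕ) : ℤ))).toTopRep e hec (fun g x => he g x) k'⟩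
  have hψ : ∀ g, ψ.1 g = e (k'.1 g) := fun _ => rfl
  have hΦκ : Φ κ = oneCocycleClass _ ψ := by rw [← hk'cl]; exact hΦ k' ψ hψ
  -- (2) the local cocycle `ψ_w = ψ ∘ res_w`
  let ρk := GaloisRep.restrictField F (W.torsionGaloisModule (((p : ℕ) : ℤ) ^ k * ((p : ℕ) : ℤ)))
  let ψw : contOneCocycles (DiscreteGaloisModule.toTopRep ρk) :=
    contOneCocycles.pullback θ (X := (W.torsionGaloisModule (((p : ℕ) : ℤ) ^ k * ((p : ℕ) : ℤ))).toTopRep)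
      (Y := DiscreteGaloisModule.toTopRep ρk) (TopRep.ofHom ⟨ContinuousLinearMap.id ℤ _, fun _ => rfl⟩) ψ
  have hψw : ∀ g, ψw.1 g = e (k'.1 (θ g)) := fun g => rfl
  have hloc : galoisCohomology.localization (W.torsionGaloisModule (((p : ℕ) : ℤ) ^ k * ((p : ℕ) : ℤ)))
      (Sum.inr w) 1 (Φ κ) = oneCocycleClass _ ψw := by
    rw [hΦκ]
    exact galoisCohomology.res_one_oneCocycleClass F ψ
  -- inertia dictionary: `res(I_{ℚ_w}) ⊆ I_{𝔓₀}`
  have hθI : ∀ u ∈ galUnr F, θ u ∈ 𝔓₀.inertia (absoluteGaloisGroup ℚ) := by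
    intro u hu
    rw [h𝔓₀def, inertia_adicCompletionPrime_eq_map_absInertia]
    rw [galUnr_eq_absInertia] at hu
    exact Subgroup.mem_map_of_mem _ hu
  -- (3) the hypotheses of the local `𝓕_u` lift (§1)
  have hkN : ∀ u : absInertia F, ψw.1 u = 0 := by
    intro u
    have hu : (u : absoluteGaloisGroup F) ∈ galUnr F := by rw [galUnr_eq_absInertia]; exact u.2
    rw [hψw, hk'app, hI (θ u) (hθI u hu), map_zero]
  have hkv : ∀ g : absoluteGaloisGroup F, ∃ t : W.tateModule p,
      (∀ n : absInertia F,
        (GaloisRep.restrictField F (T∞).toIntRep).toTopRep.ρ (n : absoluteGaloisGroup F) t = t) ∧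
        ((ψw.1 g : geomTorsion W (((p : ℕ) : ℤ) ^ k * ((p : ℕ) : ℤ))) : geomPoints W) =
          TateModule.proj p (k + 1) t := by
    intro g
    obtain ⟨t, htI, hkt⟩ := hD (θ g) ⟨g, rfl⟩
    refine ⟨t, fun n => ?_, ?_⟩
    · -- invariance under the local inertia: `t ∈ T^{I_{𝔓₀}}` and `θ(I_w) ≤ I_{𝔓₀}`
      have hn : (n : absoluteGaloisGroup F) ∈ galUnr F := by rw [galUnr_eq_absInertia]; exact n.2
      exact htI (θ n) (hθI n hn)
    · -- value: `e (red t) = π_{k+1} t`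
      rw [hψw, hk'app, hkt, ← hcomp, coe_tateToTorsion_apply]
  exact exists_unramified_tateLocalMap_eq_of_forall_vanishing_inertia W p k w ψw hkN hkv |>.imp
    fun y hy => ⟨hy.1, hy.2.trans hloc.symm⟩

/-! ### §3 Corollaries (any `p`): the `𝓕_can` condition of THEOREM D at `w`, and unramifiedness of `loc_w (Φ κ)` -/

/-- **D7-u in `ℤ`-currency for EVERY `p`** — w2-c3's
`KimAtThreeDeepUpperBadPlaceCondition.localization_mem_propagatedSelmerStructure_three_of_unramified`
with the restriction `p = 3` REMOVED (no stable range is needed on the `𝓕_u` road): under the binders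
of `exists_unramified_tateLocalMap_eq_localization_of_unramified`,
`loc_w (Φ κ) ∈ propagatedSelmerStructure W p k (Sum.inr w)` (`𝓕_u(w) ≤ 𝓕_can(w)`).
[cite: MazurRubin2004, Def. 3.2.1, Thm. 3.2.4 and App. A Remark A.5 (p. 81)]
[cite: Rubin2000, Lemma 4.4.2 and Thm. 4.5.1] -/
theorem localization_mem_propagatedSelmerStructure_of_unramified
    {ι : Type w} [Preorder ι] [OrderBot ι] {L : EulerSystemLevels ℚ ι}
    {c : ∀ (i : ι) (r : L.Ideals), H1 T∞ (L.level i r.1)} (hc : IsEulerSystem L T∞ p c)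
    {M' : Type} [AddCommGroup M'] [Module ℤ_[p] M'] [TopologicalSpace M'] [IsTopologicalAddGroup M']
    [ContinuousSMul ℤ_[p] M'] {T' : GaloisRep ℚ ℤ_[p] M'}
    (red : (T∞).toTopRep ⟶ T'.toTopRep) (k : ℕ)
    (e : M' →+ geomTorsion W (((p : ℕ) : ℤ) ^ k * ((p : ℕ) : ℤ))) (hec : Continuous e)
    (he : ∀ (g : absoluteGaloisGroup ℚ) (x : M'),
      e (T' g x) = W.torsionGaloisModule (((p : ℕ) : ℤ) ^ k * ((p : ℕ) : ℤ)) g (e x))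
    (hcomp : ∀ a : W.tateModule p, tateToTorsion W p k a = e (red.hom a))
    (Φ : continuousCohomology 1 T'.toTopRep →+
      galoisCohomology (W.torsionGaloisModule (((p : ℕ) : ℤ) ^ k * ((p : ℕ) : ℤ))) 1)
    (hΦ : ∀ (φ : contOneCocycles T'.toTopRep)
      (ψ : contOneCocycles (W.torsionGaloisModule (((p : ℕ) : ℤ) ^ k * ((p : ℕ) : ℤ))).toTopRep),
      (∀ g, ψ.1 g = e (φ.1 g)) → Φ (oneCocycleClass _ φ) = oneCocycleClass _ ψ)
    (r : L.Ideals)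
    (σ : HeightOneSpectrum (𝓞 ℚ) → absoluteGaloisGroup ℚ) (N : HeightOneSpectrum (𝓞 ℚ) → ℕ)
    (Fr : HeightOneSpectrum (𝓞 ℚ) → absoluteGaloisGroup ℚ)
    (hσ : ∀ ℓ ∈ r.1, ∀ q ∈ r.1, q ≠ ℓ → σ ℓ ∈ L.tameLevel q)
    (hcov : ∀ ℓ ∈ r.1, ∀ g : absoluteGaloisGroup ℚ, ∃ j < N ℓ, (σ ℓ ^ j)⁻¹ * g ∈ L.tameLevel ℓ)
    (hinj : ∀ ℓ ∈ r.1, ∀ j₁ < N ℓ, ∀ j₂ < N ℓ, (σ ℓ ^ j₁)⁻¹ * σ ℓ ^ j₂ ∈ L.tameLevel ℓ → j₁ = j₂)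
    (hFr : ∀ ℓ ∈ r.1, IsArithFrobAtPlace ℚ ℓ (Fr ℓ))
    (hram : ∀ ℓ ∈ r.1, ∀ s ⊆ r.1, ℓ ∉ s → ¬ SubgroupIsUnramifiedAt ℚ (L.level ⊥ (insert ℓ s)) ℓ)
    (hM₁ : ∀ ℓ ∈ r.1, ∀ v : M', (N ℓ : ℤ_[p]) • v = 0)
    (hM₂ : ∀ ℓ ∈ r.1, ∀ v : M',
      (rubinEulerFactor (T∞).toRepresentation (cyclotomicCharacterToUnits ℚ p ℤ_[p]) (Fr ℓ)).eval 1 •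
        v = 0)
    (comm)
    (h0 : ∀ v : T'.toTopRep, (∀ u : L.level ⊥ r.1, T'.toTopRep.ρ (u : absoluteGaloisGroup ℚ) v = v) →
      v = 0)
    (κ : continuousCohomology 1 T'.toTopRep)
    (hκ : resSubgroup T'.toTopRep (L.level ⊥ r.1) 1 κ =
        (r.1.noncommProd (fun ℓ => ∑ j ∈ range (N ℓ), (j : Module.End ℤ_[p] (continuousCohomology 1
          (subgroupRep T'.toTopRep (L.level ⊥ r.1)))) *
          (conjMap T'.toTopRep (L.level ⊥ r.1) (σ ℓ) 1).hom.toLinearMap ^ j) comm)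
        (ContinuousCohomology.map (ContinuousMonoidHom.id _) (X := subgroupRep (T∞).toTopRep (L.level ⊥ r.1))
          (Y := subgroupRep T'.toTopRep (L.level ⊥ r.1))
          ((TopRep.resFunctor (L.level ⊥ r.1).subtype).map red) 1 (c ⊥ r)))
    (w : HeightOneSpectrum (𝓞 ℚ)) (hwU : SubgroupIsUnramifiedAt ℚ (L.level ⊥ r.1) w)
    (hur : ∀ (s : Finset (HeightOneSpectrum (𝓞 ℚ))) (hs : s ⊆ r.1)
      (𝔓 : Ideal (absIntegers (𝓞 ℚ) ℚ)) (h𝔓 : 𝔓 ∈ w.primesAbove),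
      resLe (T∞).toTopRep (hwU 𝔓 h𝔓) 1
        (resLe (T∞).toTopRep (level_antitone L ⊥ hs) 1 (c ⊥ ⟨s, fun q hq => r.2 q (hs hq)⟩)) = 0) :
    galoisCohomology.localization (W.torsionGaloisModule (((p : ℕ) : ℤ) ^ k * ((p : ℕ) : ℤ)))
        (Sum.inr w) 1 (Φ κ) ∈ propagatedSelmerStructure W p k (Sum.inr w) :=
  mem_propagatedSelmerStructure_of_exists_tateLocalMap_eq W p k w
    (exists_unramified_tateLocalMap_eq_localization_of_unramified W p hc red k e hec he hcomp Φ hΦ r σ N Fr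
      hσ hcov hinj hFr hram hM₁ hM₂ comm h0 κ hκ w hwU hur)

end Global

end Summit.BirchSwinnertonDyer.BirchSwinnertonDyer.Theorems.KimAtThreeD7uUnramifiedMembership

end
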